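/-
Copyright (c) 2026 the pub-hodgecm-mathlib formalisation cell (harness21).  Prover seat hodgecm-mathlib-K2E3-p06 (g4), Track B «K2-LIT», engine E3, unit U4 «Keys»; deal (D61)
LINE LEAD of the open leaf (U4f-χ₁-ram-one) `U4Keys.sig_K2E3KeysThmTwoContractingRamifiedCharOne`, design D-I «THE VANISHING FUNCTIONAL»
(`K2/K2E3-p06/g4/DESIGN-M2-U4fRamifiedChar.K2E3-p06-g4.md`), brick (V1); 2026-09-04.  KERNEL module: THEOREMS ONLY (no definition, no named fact, no `sorry`, no instance, no notation).
-/
import Summits.HodgeConjecture.HodgeConjecture.Theorems.K2E3RankOneIntertwiningIntegralConvergence   -- ★ (K2E3-p04): `exists_intertwiningIntegral_of_modulus` — `A = J(w₀, χ)` with its integral formula, `|χ₁| = ‖·‖^σ`, `σ > 0`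
import Summits.HodgeConjecture.HodgeConjecture.Theorems.K2E3IntertwinerSpaceDimEqOne                   -- ★ (K2E3-p07): `exists_intertwiningMap_weylConj_ne_zero` — a non-zero `G`-map `i(χ) → i(wχ)` for regular `χ`
import Summits.HodgeConjecture.HodgeConjecture.Theorems.K2E3PSRegularReducibleCompZero                 -- ★ U4-a p855058 (K2E3-p04): reducible regular ⇒ every composition `i(χ) → i(wχ) → i(χ)` is `0`
import Summits.HodgeConjecture.HodgeConjecture.Theorems.K2E3PrincipalSeriesWeylReducible               -- ★ p855078 (K2E3-p05): `i(χ)` reducible ⇒ `i(wχ)` reducible; `conjInvChar_conjInvChar`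
import Summits.HodgeConjecture.HodgeConjecture.Theorems.K2E3SphericalCFunctionUnramifiedHypotheses      -- ★ p856288: `norm_apply_uniformizer_lt_one_of_contracting`; brings ★ `K2E3NonUnitaryCharacterDichotomy`, ★ `…ShellExpansion`
import HarnessLib

/-!
# K2 ∕ E3 «EllipticInputs», unit U4 «Keys» — (U4f-χ₁-ram-one) brick (V1): A REDUCIBLE `i_G(χ)` WITH `χ₁` NON-UNITARY CONTRACTING CONTAINS A NON-ZERO `G`-SUBREPRESENTATION
# KILLED BY THE INTERTWINING INTEGRAL — `∫_N f(w₀ n g) dn = 0` for all `f` in it and all `g`   [Casselman1995 §6.4, Thm 6.6.2; Keys1984 §3, §7; BernsteinZelevinsky1977 Thm 2.9]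

Cell hodgecm-mathlib (D-0151), FLOOR 0, Track B «K2-LIT», engine E3, crux item H413 = stmt-HodgeConjecture-24833 (route `HCCMUnconditional`, no route verbs); target BY NAME
the OPEN leaf `…K2E3EllipticInputs.U4Keys.sig_K2E3KeysThmTwoContractingRamifiedCharOne` (U4Keys ED. 7), via design D-I.  Author K2E3-p06 (g4), line lead (D61).
`--supports stmt-HodgeConjecture-24833 --as helper`; THEOREMS ONLY.  NOT THE PAYER: first brick of the line (any conductor, any `χ₂`).

THE POINT (design D-I, §0 (V1)).  The classical road to Keys' list computes the composition scalar `J(w₀⁻¹, wχ)∘J(w₀, χ) = γ(χ)·id`, which needs the counter-operator OUTSIDE its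
half-plane of convergence (meromorphic continuation).  For the IMPLICATION «reducible ⟹ list» none of that is needed: everything follows from three ★ facts about the CONVERGENT
operator `A = J(w₀, χ)` (`χ₁` contracting ⇒ `|χ₁| = ‖·‖^σ`, `σ > 0`, §1; ★ `exists_intertwiningIntegral_of_modulus`) and ONE algebraic non-zero `G`-map `B : i(wχ) → i(χ)` (★
`exists_intertwiningMap_weylConj_ne_zero` at the regular character `wχ`, `w(wχ) = χ` ★ `conjInvChar_conjInvChar`): if `i(χ)` is reducible then so is `i(wχ)` (★
`cmPrincipalSeries_weylConj_reducible_of_reducible`), hence BOTH compositions vanish (★ U4-a at `χ`: `B∘A = 0`; at `wχ`: `A∘B = 0`), so `V := range B` is a NON-ZERO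
`G`-subrepresentation of `i(χ)` on which `A` vanishes — i.e. **`∫_N f(w₀ n g) dn = 0` for every `f ∈ V` and every `g ∈ G`** — and `V` contains a section with `f(1) ≠ 0`
(translate any non-zero `f ∈ V`).  The rest of the line (V2)–(V6) extracts Keys' list from this vanishing by FINITELY many absolutely convergent cell integrals (no `γ`, no `B`-formula).
* §1 `exists_rpow_modulus_of_contracting` — (H3) WITHOUT the unramified hypothesis: a continuous contracting `χ₁` has `|χ₁| = ‖·‖^s` with `s > 0` (any conductor).
* §2 **`exists_subrep_ne_bot_forall_intertwiningIntegral_eq_zero`** — the statement above, for every continuous `χ₂` and every Haar measure on `N(L⁺_v)`.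
* §3 **`exists_section_apply_one_ne_zero_forall_intertwiningIntegral_eq_zero`** — the pointed form: `∃ f ∈ V`, `f(1) ≠ 0`.
HONEST LABEL: HC_CM is proved only modulo the 7 printed citations (2 remaining named inputs: hLiu418 = stmt-HodgeConjecture-24832, h413 = stmt-HodgeConjecture-24833)
until rung 0 closes; count-neutral — this file does NOT pay the leaf; no printed citation is discharged.

## References
* [Casselman1995] W. Casselman, *Introduction to the theory of admissible representations of `p`-adic reductive groups* (1995), §6.4 pp. 62–64 (the operators `T_w` on their cone of
  convergence), Thm. 6.6.2 p. 66 (irreducibility ⟺ the intertwining operators are isomorphisms).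
* [Keys1984] D. Keys, *Principal series representations of special unitary groups over local fields*, Compositio Math. 51 (1984), §3 (the operators `A(w, λ)`), §7 Thm (2) p. 126.
* [BernsteinZelevinsky1977] I. N. Bernstein, A. V. Zelevinsky, *Induced representations of reductive `p`-adic groups I*, Ann. Sci. ÉNS 10 (1977), Thm. 2.9 (`i(χ)` and `i(wχ)` have the
  same constituents).
* [Rogawski1990] J. D. Rogawski, *Automorphic Representations of Unitary Groups in Three Variables*, Ann. of Math. Stud. 123 (1990), §12.1 p. 171, §12.2 p. 173.
-/

set_option autoImplicit false
-- the mandated namespace has the single-problem summit's repeated segment (`HodgeConjecture.HodgeConjecture`)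
set_option linter.dupNamespace false

noncomputable section

open NumberField IsDedekindDomain MeasureTheory
open scoped Matrix MatrixGroups NNReal ENNReal
open Literature.NumberTheory Literature.NumberTheory.Automorphic Literature.NumberTheory.Automorphic.UnitaryGroup
open Literature.NumberTheory.Rogawski1990 Literature.NumberTheory.GaloisRepresentations Literature.NumberTheory.GaloisRepresentations.IsNonarchimedeanLocalField

namespace Summit.HodgeConjecture.HodgeConjecture.Cruxes.H413.K2E3IntertwiningKernelOfReducible

open Summit.HodgeConjecture.HodgeConjecture.Cruxes.H413 Summit.HodgeConjecture.HodgeConjecture.Cruxes.H413.F0P2pTorusPairsAndVacuity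

variable (L : Type) [Field L] [NumberField L] [IsCMField L] (v : HeightOneSpectrum (𝓞 ↥(maximalRealSubfield L)))

/-! ## §1 (H3) at any conductor: a contracting `χ₁` is `|χ₁| = ‖·‖^s`, `s > 0` -/

/-- **`|χ₁(x)| = ‖x‖^s` with `s = log|χ₁(ϖ)| ∕ log‖ϖ‖ > 0`** for a CONTINUOUS contracting `χ₁` — no unramified hypothesis (★ p856288 §2 verbatim with ★
`norm_apply_eq_norm_uniformizer_zpow` (`|χ₁| = 1` on the compact `𝒪_vˣ`, any conductor) in place of `apply_eq_apply_uniformizer_zpow`): `x = ϖⁿu` (★ `exists_uniformizer_zpow_mul`),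
`|χ₁ x| = |χ₁ ϖ|ⁿ`, `‖x‖ = ‖ϖ‖ⁿ`, `‖ϖ‖^s = |χ₁ ϖ|` (`0 < ‖ϖ‖ < 1` ★, `|χ₁ ϖ| < 1` by contraction ★ `norm_apply_uniformizer_lt_one_of_contracting`).  Keys' `λ_s = λ|·|_E^s`, `λ`
unitary of ANY conductor, `Re s > 0`. [cite: Keys1984, §1 p. 116; §7 p. 126] [cite: Casselman1995, §6.4] -/
theorem exists_rpow_modulus_of_contracting (hns : ∀ w : PlacesOver L v, IsCMField.complexConj L • w.1 = w.1) (χ₁ : (LocalRing L v)ˣ →* ℂˣ)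
    (h₁ : Continuous fun x => ((χ₁ x : ℂˣ) : ℂ)) (hcontr : ∀ x : (LocalRing L v)ˣ, unitModulusChar (LocalRing L v) x < 1 → ‖((χ₁ x : ℂˣ) : ℂ)‖ < 1) :
    ∃ s : ℝ, 0 < s ∧ ∀ x : (LocalRing L v)ˣ, ‖((χ₁ x : ℂˣ) : ℂ)‖ = ((unitModulusChar (LocalRing L v) x : ℝ≥0) : ℝ) ^ s := by
  obtain ⟨ϖ, hϖ⟩ := F0P3cStCharTSTorusRay.exists_uniformizer_units L v
  have hz : ‖((χ₁ ϖ : ℂˣ) : ℂ)‖ < 1 := K2E3SphericalCFunctionUnramifiedHypotheses.norm_apply_uniformizer_lt_one_of_contracting L v hns χ₁ hcontr ϖ hϖ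
  have ha0 : 0 < ((unitModulusChar (LocalRing L v) ϖ : ℝ≥0) : ℝ) := NNReal.coe_pos.2 distribHaarChar_pos
  have ha1 : ((unitModulusChar (LocalRing L v) ϖ : ℝ≥0) : ℝ) < 1 := by
    exact_mod_cast K2E3SphericalCFunctionShellExpansion.unitModulusChar_uniformizer_lt_one L v hns ϖ hϖ
  have hz0 : 0 < ‖((χ₁ ϖ : ℂˣ) : ℂ)‖ := norm_pos_iff.2 (Units.ne_zero _)
  have hla : Real.log ((unitModulusChar (LocalRing L v) ϖ : ℝ≥0) : ℝ) < 0 := Real.log_neg ha0 ha1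
  have hlz : Real.log ‖((χ₁ ϖ : ℂˣ) : ℂ)‖ < 0 := Real.log_neg hz0 hz
  refine ⟨Real.log ‖((χ₁ ϖ : ℂˣ) : ℂ)‖ / Real.log ((unitModulusChar (LocalRing L v) ϖ : ℝ≥0) : ℝ), div_pos_of_neg_of_neg hlz hla, fun x => ?_⟩
  -- `‖ϖ‖^s = |χ₁(ϖ)|`
  have hs : ((unitModulusChar (LocalRing L v) ϖ : ℝ≥0) : ℝ) ^ (Real.log ‖((χ₁ ϖ : ℂˣ) : ℂ)‖ / Real.log ((unitModulusChar (LocalRing L v) ϖ : ℝ≥0) : ℝ)) =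
      ‖((χ₁ ϖ : ℂˣ) : ℂ)‖ := by
    rw [Real.rpow_def_of_pos ha0, mul_div_cancel₀ _ hla.ne, Real.exp_log hz0]
  -- `x = ϖⁿ u`, `|χ₁ x| = |χ₁ ϖ|ⁿ`, `‖x‖ = ‖ϖ‖ⁿ`
  obtain ⟨n, u, hu, hx, -⟩ := K2E3NonUnitaryCharacterDichotomy.exists_uniformizer_zpow_mul L v hns ϖ hϖ x
  have hχx : ‖((χ₁ x : ℂˣ) : ℂ)‖ = ‖((χ₁ ϖ : ℂˣ) : ℂ)‖ ^ n := by
    rw [hx]; exact K2E3NonUnitaryCharacterDichotomy.norm_apply_eq_norm_uniformizer_zpow L v χ₁ h₁ ϖ u n hu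
  have hmx : unitModulusChar (LocalRing L v) x = unitModulusChar (LocalRing L v) ϖ ^ n := by
    rw [hx, map_mul, map_zpow, unitModulusChar_eq_one_of_forall_v_eq_one L v u ((F0P3cStCharTSTorusCompactPart.mem_unitsIntegers_iff L v u).1 hu), mul_one]
  rw [hχx, hmx, NNReal.coe_zpow, ← Real.rpow_intCast, ← Real.rpow_intCast, ← Real.rpow_mul ha0.le, mul_comm, Real.rpow_mul ha0.le, hs]

/-! ## §2 The kernel of `J(w₀, χ)` on a reducible `i_G(χ)` -/

set_option maxHeartbeats 8000000 in
set_option synthInstance.maxHeartbeats 400000 in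
-- statement∕proof over two `cmPrincipalSeries` carriers + `IntertwiningMap` types rewritten along `w(wχ) = χ` (class of ★ `cmPrincipalSeries_reducible_of_weylConj_reducible`)
/-- **A REDUCIBLE `i_G(χ₁, χ₂)` WITH `χ₁` NON-UNITARY CONTRACTING CONTAINS A NON-ZERO `G`-SUBREPRESENTATION KILLED BY `J(w₀, χ)`.**  `v` non-split; `χ₁, χ₂` continuous, `χ₁`
non-unitary (`hnu`) and contracting (`hcontr`) — ANY conductor; `w₀` of matrix `Φ₃`; `μ` any Haar measure on `N(L⁺_v)`; `i_G(χ)` reducible.  Then there are a `G`-map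
`A : i(χ) → i(wχ)` with the INTEGRAL FORMULA `(A f)(g) = ∫_N f(w₀ n g) dn` (★ `exists_intertwiningIntegral_of_modulus`, §1), and a subrepresentation `V ≠ ⊥` of `i(χ)` with `A f = 0`
for all `f ∈ V` — `V = range B` for the ★ algebraic non-zero `B : i(wχ) → i(χ)`, since `B∘A = 0` (★ U4-a at `χ`) and `A∘B = 0` (★ U4-a at the reducible `i(wχ)`, ★
`cmPrincipalSeries_weylConj_reducible_of_reducible`, types rewritten by ★ `conjInvChar_conjInvChar`).  No composition scalar, no counter-operator formula, no length count.
[cite: Casselman1995, §6.4; Thm. 6.6.2 p. 66] [cite: Keys1984, §3, §7 Thm (2)] [cite: BernsteinZelevinsky1977, Thm. 2.9] [cite: Rogawski1990, §12.2 p. 173] -/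
theorem exists_subrep_ne_bot_forall_intertwiningIntegral_eq_zero
    (hns : ∀ w : PlacesOver L v, IsCMField.complexConj L • w.1 = w.1)
    (χ₁ : (LocalRing L v)ˣ →* ℂˣ) (χ₂ : ↥(normOneUnits (conjLocal L (IsCMField.complexConj L) v)) →* ℂˣ)
    (h₁ : Continuous fun x => ((χ₁ x : ℂˣ) : ℂ)) (h₂ : Continuous fun x => ((χ₂ x : ℂˣ) : ℂ)) (hnu : ∃ x, ‖((χ₁ x : ℂˣ) : ℂ)‖ ≠ 1)
    (hcontr : ∀ x : (LocalRing L v)ˣ, unitModulusChar (LocalRing L v) x < 1 → ‖((χ₁ x : ℂˣ) : ℂ)‖ < 1)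
    (hred : ∃ N : Subrepresentation (cmPrincipalSeries L 3 v (cmTorusCharPair L v χ₁ χ₂)), N ≠ ⊥ ∧ N ≠ ⊤)
    (w₀ : ↥(unitaryGroupOfForm (conjLocal L (IsCMField.complexConj L) v) (cmLocalForm L 3 v))) (hw₀ : Units.val (w₀ : GL (Fin 3) (LocalRing L v)) = cmLocalForm L 3 v)
    [MeasurableSpace ↥(cmBorelTriple L 3 v).N] [BorelSpace ↥(cmBorelTriple L 3 v).N] (μ : Measure ↥(cmBorelTriple L 3 v).N) [μ.IsHaarMeasure] :
    ∃ (A : (cmPrincipalSeries L 3 v (cmTorusCharPair L v χ₁ χ₂)).IntertwiningMap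
        (cmPrincipalSeries L 3 v (cmTorusCharPair L v (conjInvChar (conjLocal L (IsCMField.complexConj L) v) χ₁) χ₂)))
      (V : Subrepresentation (cmPrincipalSeries L 3 v (cmTorusCharPair L v χ₁ χ₂))),
      A ≠ 0 ∧ V ≠ ⊥ ∧
      (∀ (f : haveI := locallyCompactSpace_cmBorelU L 3 v
          Representation.SmoothInd (cmBorelTriple L 3 v).P
        (Representation.twist
          (((Representation.trivial ℂ ↥(torusU (conjLocal L (IsCMField.complexConj L) v) (cmLocalForm L 3 v)) ℂ).twist
            (cmTorusCharPair L v χ₁ χ₂)).comp (cmBorelTriple L 3 v).proj) (rootDeltaChar (cmBorelTriple L 3 v).P)))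
        (g : ↥(unitaryGroupOfForm (conjLocal L (IsCMField.complexConj L) v) (cmLocalForm L 3 v))),
        (A f).toFun g = ∫ n : ↥(cmBorelTriple L 3 v).N, f.toFun (w₀ * (n : ↥(unitaryGroupOfForm (conjLocal L (IsCMField.complexConj L) v) (cmLocalForm L 3 v))) * g) ∂μ) ∧
      ∀ f, f ∈ V → A f = 0 := by
  haveI := locallyCompactSpace_cmBorelU L 3 v
  -- regularity, the exponent, the operator `A = J(w₀, χ)`
  have hreg := K2E3NonUnitaryCharacterDichotomy.cmTorusCharPair_ne_weyl_of_exists_norm_ne_one L v hns χ₁ χ₂ h₁ hnu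
  obtain ⟨s, hs, hχ₁⟩ := exists_rpow_modulus_of_contracting L v hns χ₁ h₁ hcontr
  obtain ⟨A, hA0, hA⟩ := K2E3RankOneIntertwiningIntegralConvergence.exists_intertwiningIntegral_of_modulus L v hns χ₁ χ₂ h₁ h₂ hs hχ₁ w₀ hw₀ μ
  -- `w(wχ) = χ`, and the data at `wχ`
  have hww : conjInvChar (conjLocal L (IsCMField.complexConj L) v) (conjInvChar (conjLocal L (IsCMField.complexConj L) v) χ₁) = χ₁ :=
    conjInvChar_conjInvChar _ (conjLocal_conjLocal_cm L v) χ₁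
  have h₁' : Continuous fun x => ((conjInvChar (conjLocal L (IsCMField.complexConj L) v) χ₁ x : ℂˣ) : ℂ) :=
    continuous_coe_conjInvChar _ (continuous_conjLocal L (IsCMField.complexConj L) v) χ₁ h₁
  have hreg' : cmTorusCharPair L v (conjInvChar (conjLocal L (IsCMField.complexConj L) v) χ₁) χ₂ ≠
      cmTorusCharPair L v (conjInvChar (conjLocal L (IsCMField.complexConj L) v) (conjInvChar (conjLocal L (IsCMField.complexConj L) v) χ₁)) χ₂ := by
    rw [hww]; exact hreg.symm
  have hred' := K2E3PrincipalSeriesWeylReducible.cmPrincipalSeries_weylConj_reducible_of_reducible L v hns χ₁ χ₂ h₁ h₂ hreg hred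
  -- the algebraic non-zero `B : i(wχ) → i(w(wχ)) = i(χ)`
  have hB := K2E3IntertwinerSpaceDimEqOne.exists_intertwiningMap_weylConj_ne_zero L v hns (conjInvChar (conjLocal L (IsCMField.complexConj L) v) χ₁) χ₂ h₁' h₂ hreg'
  rw [hww] at hB
  obtain ⟨B, hB0⟩ := hB
  -- both compositions vanish (★ U4-a at `χ` and at `wχ`)
  have hBA : B.comp A = 0 := K2E3PSRegularReducibleCompZero.PSRegularReducibleCompZero L v hns χ₁ χ₂ h₁ h₂ hreg hred A B
  have hU' := K2E3PSRegularReducibleCompZero.PSRegularReducibleCompZero L v hns (conjInvChar (conjLocal L (IsCMField.complexConj L) v) χ₁) χ₂ h₁' h₂ hreg' hred'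
  rw [hww] at hU'
  have hAB : A.comp B = 0 := hU' B A
  -- `V := range B ≠ ⊥`, `A|_V = 0`
  refine ⟨A, B.range, hA0, fun hbot => hB0 ?_, hA, fun f hf => ?_⟩
  · apply Representation.IntertwiningMap.toFun_injective
    funext x
    have hx : B x ∈ B.range := (Representation.IntertwiningMap.mem_range _ _ B (B x)).2 ⟨x, rfl⟩
    rw [hbot] at hx
    change B x ∈ ((⊥ : Subrepresentation (cmPrincipalSeries L 3 v (cmTorusCharPair L v χ₁ χ₂))).toSubmodule) at hx
    have hx0 : B x = 0 := (Submodule.mem_bot ℂ).1 hx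
    simp only [LinearMap.toFun_eq_coe, Representation.IntertwiningMap.coe_toLinearMap, hx0, Representation.IntertwiningMap.zero_toLinearMap, LinearMap.zero_apply]
  · obtain ⟨x, rfl⟩ := (Representation.IntertwiningMap.mem_range _ _ B f).1 hf
    have h := congrArg (fun (T : (cmPrincipalSeries L 3 v (cmTorusCharPair L v (conjInvChar (conjLocal L (IsCMField.complexConj L) v) χ₁) χ₂)).IntertwiningMap
        (cmPrincipalSeries L 3 v (cmTorusCharPair L v (conjInvChar (conjLocal L (IsCMField.complexConj L) v) χ₁) χ₂))) => T x) hAB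
    simpa only [Representation.IntertwiningMap.comp_apply, Representation.IntertwiningMap.coe_zero, Pi.zero_apply] using h

/-! ## §3 Pointed form: a section with `f(1) ≠ 0` whose intertwining integrals all vanish -/

set_option maxHeartbeats 8000000 in
set_option synthInstance.maxHeartbeats 400000 in
-- as §2
/-- **`∃ f ∈ i_G(χ)`, `f(1) ≠ 0`, with `∫_N f(w₀ n g) dn = 0` for EVERY `g`** — and `f` lies in a `G`-subrepresentation `V ≠ ⊥` all of whose members have the same property (§2;
a non-zero `f₀ ∈ V` has `f₀(g₀) ≠ 0` somewhere, and `g₀ · f₀ ∈ V` has `(g₀·f₀)(1) = f₀(g₀)`).  This is the input of brick (V2) (type-vector averaging inside `V`).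
[cite: Casselman1995, §6.4; Thm. 6.6.2] [cite: Keys1984, §3, §7 Thm (2)] -/
theorem exists_section_apply_one_ne_zero_forall_intertwiningIntegral_eq_zero
    (hns : ∀ w : PlacesOver L v, IsCMField.complexConj L • w.1 = w.1)
    (χ₁ : (LocalRing L v)ˣ →* ℂˣ) (χ₂ : ↥(normOneUnits (conjLocal L (IsCMField.complexConj L) v)) →* ℂˣ)
    (h₁ : Continuous fun x => ((χ₁ x : ℂˣ) : ℂ)) (h₂ : Continuous fun x => ((χ₂ x : ℂˣ) : ℂ)) (hnu : ∃ x, ‖((χ₁ x : ℂˣ) : ℂ)‖ ≠ 1)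
    (hcontr : ∀ x : (LocalRing L v)ˣ, unitModulusChar (LocalRing L v) x < 1 → ‖((χ₁ x : ℂˣ) : ℂ)‖ < 1)
    (hred : ∃ N : Subrepresentation (cmPrincipalSeries L 3 v (cmTorusCharPair L v χ₁ χ₂)), N ≠ ⊥ ∧ N ≠ ⊤)
    (w₀ : ↥(unitaryGroupOfForm (conjLocal L (IsCMField.complexConj L) v) (cmLocalForm L 3 v))) (hw₀ : Units.val (w₀ : GL (Fin 3) (LocalRing L v)) = cmLocalForm L 3 v)
    [MeasurableSpace ↥(cmBorelTriple L 3 v).N] [BorelSpace ↥(cmBorelTriple L 3 v).N] (μ : Measure ↥(cmBorelTriple L 3 v).N) [μ.IsHaarMeasure] :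
    ∃ (V : Subrepresentation (cmPrincipalSeries L 3 v (cmTorusCharPair L v χ₁ χ₂)))
      (f : haveI := locallyCompactSpace_cmBorelU L 3 v
          Representation.SmoothInd (cmBorelTriple L 3 v).P
        (Representation.twist
          (((Representation.trivial ℂ ↥(torusU (conjLocal L (IsCMField.complexConj L) v) (cmLocalForm L 3 v)) ℂ).twist
            (cmTorusCharPair L v χ₁ χ₂)).comp (cmBorelTriple L 3 v).proj) (rootDeltaChar (cmBorelTriple L 3 v).P))),
      f ∈ V ∧ f.toFun 1 ≠ 0 ∧
      ∀ f', f' ∈ V → ∀ g : ↥(unitaryGroupOfForm (conjLocal L (IsCMField.complexConj L) v) (cmLocalForm L 3 v)),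
        ∫ n : ↥(cmBorelTriple L 3 v).N, f'.toFun (w₀ * (n : ↥(unitaryGroupOfForm (conjLocal L (IsCMField.complexConj L) v) (cmLocalForm L 3 v))) * g) ∂μ = 0 := by
  haveI := locallyCompactSpace_cmBorelU L 3 v
  obtain ⟨A, V, -, hV, hA, hAV⟩ := exists_subrep_ne_bot_forall_intertwiningIntegral_eq_zero L v hns χ₁ χ₂ h₁ h₂ hnu hcontr hred w₀ hw₀ μ
  -- the vanishing of every intertwining integral on `V`
  have hzero : ∀ f', f' ∈ V → ∀ g : ↥(unitaryGroupOfForm (conjLocal L (IsCMField.complexConj L) v) (cmLocalForm L 3 v)),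
      ∫ n : ↥(cmBorelTriple L 3 v).N, f'.toFun (w₀ * (n : ↥(unitaryGroupOfForm (conjLocal L (IsCMField.complexConj L) v) (cmLocalForm L 3 v))) * g) ∂μ = 0 := by
    intro f' hf' g
    rw [← hA f' g, hAV f' hf']
    rfl
  -- a non-zero member of `V`, translated so that its value at `1` is non-zero
  have hex : ∃ f₀, f₀ ∈ V ∧ f₀ ≠ 0 := by
    by_contra hno
    push Not at hno
    apply hV
    apply le_bot_iff.1
    intro f₀ hf₀
    have h0 : f₀ = 0 := hno f₀ hf₀
    rw [h0]
    exact (⊥ : Subrepresentation (cmPrincipalSeries L 3 v (cmTorusCharPair L v χ₁ χ₂))).toSubmodule.zero_mem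
  obtain ⟨f₀, hf₀V, hf₀0⟩ := hex
  have hg₀ : ∃ g₀ : ↥(unitaryGroupOfForm (conjLocal L (IsCMField.complexConj L) v) (cmLocalForm L 3 v)), f₀.toFun g₀ ≠ 0 := by
    by_contra hno
    push Not at hno
    exact hf₀0 (Representation.SmoothInd.ext (funext hno))
  obtain ⟨g₀, hg₀⟩ := hg₀
  refine ⟨V, (cmPrincipalSeries L 3 v (cmTorusCharPair L v χ₁ χ₂)) g₀ f₀, V.apply_mem_toSubmodule g₀ hf₀V, ?_, hzero⟩
  have e : ((cmPrincipalSeries L 3 v (cmTorusCharPair L v χ₁ χ₂)) g₀ f₀).toFun 1 = f₀.toFun (1 * g₀) := Representation.toFun_smoothIndRep_apply g₀ f₀ 1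
  rw [e, one_mul]
  exact hg₀

end Summit.HodgeConjecture.HodgeConjecture.Cruxes.H413.K2E3IntertwiningKernelOfReducible

end
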